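import Mathlib.Logic.Function.Basic
import Mathlib.Data.Nat.Notation
import Mathlib.Tactic.Common
import HarnessLib

/-!
# Liu 2021, App. D Lemma D.1 (2)–(4): contragredient and isomorphism criteria for the local oscillator
# representations `ω(μ, ε, χ)` of a non-archimedean unitary group (typed skeleton over bare carriers)

Yifeng Liu, *Fourier–Jacobi cycles and arithmetic relative trace formula* (with an appendix by Chao Li and Yihang Zhu),
Cambridge J. Math. **9** (2021), no. 1, 1–147 = arXiv:2102.11518 [Liu2021].  Source read: held extraction
`paper:arxiv-2102.11518`, chunk p0056 L5–L29 (arXiv 'Lemma 10.1'), checked against the author's TeX `FJcycle.tex`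
(arXiv e-print; `\appendix` l. 4010, fourth appendix "Cohomology of unitary Shimura curves" l. 5201, lemma
`le:weil_nonarch` ll. 5226–5238) — so the lemma is **App. D, Lemma D.1** of the compiled arXiv version (the sibling
record `LocalOscillatorRepresentation.lean` calls the same lemma "App. B §B.1 Lemma B.1 (arXiv Lemma 10.1)"; both pin
arXiv Lemma 10.1, p. 56; the Cambridge J. Math. lettering is unconfirmed).

WHY THIS FILE.  The sibling `LocalOscillatorRepresentation.lean` types the FIRST SENTENCE of Lemma D.1 and its bullet
(1) for ONE triple (`LocalOscillatorDatum.IrreducibleAdmissible`: the maximal `χ`-quotient is admissible, irreducible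
when non-zero, non-zero unless `n = 2`).  Bullets (2)–(4) COMPARE the representations attached to DIFFERENT triples
`(μ, ε, χ)`; they are the only printed anchor of the separation hypothesis "distinct first entries `μ` give
non-isomorphic `ω(μ,ε,χ)`" carried explicitly by the global records (`hμ` of
`Literature.AlgebraicGeometry.Liu2021.LiuAlbaneseDatum.Prop413.mult_le_one` and of
`LiuAlbaneseDatum.Prop413.h1mult_omega_eq_one`; the stage-1 package's `MuSeparated`), and of [Liu2021] Thm. 4.18 (2)
("Statement (2) follows from Lemma D.1", proof of Thm. 4.18, chunk p0023 L19).  This file types bullets (2)–(4) AS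
PRINTED over a bare family datum and proves the injectivity corollary of (3) in the kernel.

AS PRINTED (p0056 L5–L29; dropped macro symbols restored in `⟦·⟧` from the TeX).  Standing: "Let `F` be a local field
whose characteristic is not `2`. Let `E` be an étale `F`-algebra of rank `2`. Denote by `⟦c⟧` the unique nontrivial
involution on `E` that fixes `F`, and put `E^− := {x ∈ E | x + x^⟦c⟧ = 0}` and `E¹ := {x ∈ E | x x^⟦c⟧ = 1}`. Let
`⟦V⟧, ( , )_⟦V⟧` be a (non-degenerate) hermitian space over `E` (with respect to `⟦c⟧`) of rank `n ≥ 2`."  Steps 1–3: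
`ε ∈ E^{−×}/N_{E/F}E^×` ↦ `ω(ε)` (oscillator representation of `Mp(V_ε)` for `ψ_F`); `μ : E^× → ℂ¹` with
`μ|_{F^×}` = "the unique character whose kernel is exactly `N_{E/F}E^×`" ↦ `ω(μ,ε) := ω(ε) ∘ ι_μ`; `χ : E¹ → ℂ¹` ↦
`ω(μ,ε,χ)` := "the maximal quotient of the representation `ω(ε,μ)` of `⟦U⟧(⟦V⟧)` with central character `χ`";
"For `χ` in Step 3, we define a character `⟦χ̌⟧` of `E^×` via the formula `⟦χ̌⟧(x) = χ(x/x^⟦c⟧)`."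
**Lemma D.1.** "Suppose that `F` is nonarchimedean. Then `ω(μ,ε,χ)` is irreducible and admissible. Moreover,
(1) `ω(μ,ε,χ)` is zero if and only if `E` is a field, `⟦V⟧` is anisotropic (in particular `n = 2`), and `⟦χ̌⟧ = μ²`.
(2) The contragredient representation of `ω(μ,ε,χ)` is isomorphic to `ω(μ^⟦c⟧, −ε, χ^{−1})`, where `μ^⟦c⟧ := μ ∘ ⟦c⟧`
as usual.
(3) If `n ≥ 3`, then `ω(μ',ε',χ')` is isomorphic to `ω(μ,ε,χ)` if and only if `(μ',ε',χ') = (μ,ε,χ)`.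
(4) If `n = 2` and `ω(μ,ε,χ)` is nonzero, then `ω(μ',ε',χ')` is isomorphic to `ω(μ,ε,χ)` if and only if either
`(μ',ε',χ') = (μ,ε,χ)`, or `μ' = μ^⟦c⟧⟦χ̌⟧`, `χ' = χ`, and `ε' = ε` (resp. `ε' ≠ ε`) when `⟦V⟧` is isotropic (resp.
anisotropic)."  [TeX l. 5235: `\mu'=\mu^\tc\check\chi`; the held extraction p0056 L29 prints `$\mu'=\mu^ $` — BOTH the
involution macro `\tc` and the twist `\check\chi` are dropped there; the proof, TeX l. 5257, confirms "either `μ' = μ` or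
`μ' = μ^c χ̌`".  ERRATUM 2026-08-20T22:2xZ: the first landed revision of this file (p238614) transcribed (4) from the
extraction as `μ' = μ^c`, omitting the twist by `χ̌`; corrected here in place — the record had no importer.]
Proof inputs named there (p0056 L31–p0057 L3): split case via unitary parabolic induction [GR90] 2.6;
Howe duality [GT16] Thm 1.1 (1); persistence / first occurrence [HKS] Prop. 5.1 (iii), Speculations 7.5–7.6 = [SZ15]
Thm 1.10; [HKS] Lemma 1.1 & (1.8) for (2); "[GR90] Proposition 5.1.4" for (3) at `n = 3` ("the same proof also works
for `n > 3`"); endoscopic packets [GGP2] §8 and Thm 10.2 for (4).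

TYPING.  One local place is fixed; the carriers are BARE TYPES (a hypothesis structure, nothing asserted): `Mu` = the
characters `μ` of Step 2, `Eps` = `E^{−×}/N_{E/F}E^×`, `Chi` = characters of `E¹`, `Rep` = ISOMORPHISM CLASSES of
smooth representations of `U(V)(F)` (so print's "is isomorphic to" is EQUALITY in `Rep`), `omega μ ε χ = [ω(μ,ε,χ)]`,
`zero = [0]`, `conj μ = μ^c`, `conjMulCheck μ χ = μ^c·χ̌` (again a character of Step 2: `χ̌|_{F^×} = 1`),
`neg ε = −ε`, `inv χ = χ^{−1}`, `dual ρ = [ρ^∨]`, `rank = n`, `IsField` = "`E` is a field", `Isotropic` = "`V` is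
isotropic".  Bullet (1) is NOT re-typed here (it is the sibling's
`IrreducibleAdmissible`, clause `rank ≠ 2 → Nontrivial`).  As for every datum-style record of this directory the
propositions are in general false over an arbitrary datum; a consumer cites them only at an instance whose fields ARE
print's objects (object match = §3 of the sibling's module docstring, items (a)–(e), (om1), (om2)).

## References

* [Liu2021] Y. Liu, Camb. J. Math. 9 (2021) 1–147 = arXiv:2102.11518 — App. D §D.1 Steps 1–3 and Lemma D.1 (arXiv
  §10.1, Lemma 10.1, p. 56).
* [GelbartRogawski1991], [HarrisKudlaSweet1996] — inputs of Liu's proof (quoted by Liu; not used here).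
-/

namespace Literature.RepresentationTheory.Liu2021

universe u

/-- **Bare carriers for [Liu2021, App. D §D.1] at ONE non-archimedean place** (a hypothesis structure; nothing is
asserted): `Mu` — characters `μ : E^× → ℂ¹` with `μ|_{F^×}` the quadratic character of kernel `N_{E/F}E^×` (Step 2);
`Eps` — classes `ε ∈ E^{−×}/N_{E/F}E^×` (Step 1); `Chi` — characters `χ : E¹ → ℂ¹` (Step 3); `Rep` — isomorphism
classes of smooth representations of `U(V)(F)`; `omega μ ε χ` — the class of `ω(μ,ε,χ)` (Step 3); `zero` — the class
of the zero representation; `conj μ = μ^c := μ ∘ c`, `conjMulCheck μ χ = μ^c · χ̌` with `χ̌(x) := χ(x/x^c)`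
("For `χ` in Step 3, we define a character `χ̌` of `E^×` …", p0056 L18), `neg ε = −ε`, `inv χ = χ⁻¹`, `dual ρ` — the
class of the contragredient; `rank` — `n = rank_E V` with print's standing `n ≥ 2`; `IsField` — "`E` is a field"; `Isotropic` —
"`V` is isotropic". [cite: Liu2021, App. D §D.1 Steps 1–3 (arXiv §10.1, p. 56)] -/
structure LocalOscillatorFamily where
  /-- characters `μ` of Step 2 -/
  Mu : Type u
  /-- `E^{−×}/N_{E/F}E^×` -/
  Eps : Type u
  /-- characters of `E¹` -/
  Chi : Type u
  /-- isomorphism classes of smooth representations of `U(V)(F)` -/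
  Rep : Type u
  /-- `(μ, ε, χ) ↦ [ω(μ, ε, χ)]` -/
  omega : Mu → Eps → Chi → Rep
  /-- the class of the zero representation -/
  zero : Rep
  /-- `μ ↦ μ^c = μ ∘ c` -/
  conj : Mu → Mu
  /-- `(μ, χ) ↦ μ^c · χ̌`, `χ̌(x) = χ(x/x^c)` (the twisted conjugate occurring in Lemma D.1 (4)) -/
  conjMulCheck : Mu → Chi → Mu
  /-- `ε ↦ −ε` -/
  neg : Eps → Eps
  /-- `χ ↦ χ⁻¹` -/
  inv : Chi → Chi
  /-- `[ρ] ↦ [ρ^∨]` (contragredient) -/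
  dual : Rep → Rep
  /-- print's `n = rank_E V` -/
  rank : ℕ
  /-- print's standing hypothesis "of rank `n ≥ 2`" -/
  two_le_rank : 2 ≤ rank
  /-- "`E` is a field" (as opposed to `E = F × F`) -/
  IsField : Prop
  /-- "`V` is isotropic" -/
  Isotropic : Prop

namespace LocalOscillatorFamily

/-- **[Liu2021, App. D Lemma D.1 (2)]** (p0056 L25), AS PRINTED: "The contragredient representation of `ω(μ,ε,χ)` is
isomorphic to `ω(μ^c, −ε, χ^{−1})`, where `μ^c := μ ∘ c` as usual."  TYPING: equality of classes in `Rep`.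
[cite: Liu2021, App. D Lemma D.1 (2) (arXiv Lemma 10.1 (2), p. 56)] -/
def LemmaD1_2 (D : LocalOscillatorFamily.{u}) : Prop :=
  ∀ (μ : D.Mu) (ε : D.Eps) (χ : D.Chi), D.dual (D.omega μ ε χ) = D.omega (D.conj μ) (D.neg ε) (D.inv χ)

/-- **[Liu2021, App. D Lemma D.1 (3)]** (p0056 L27), AS PRINTED: "If `n ≥ 3`, then `ω(μ',ε',χ')` is isomorphic to
`ω(μ,ε,χ)` if and only if `(μ',ε',χ') = (μ,ε,χ)`."  TYPING: for `3 ≤ rank`, equality of classes in `Rep` iff equality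
of the triples.  This is the local print anchor of the global separation hypotheses `hμ` / `MuSeparated` and of
[Liu2021] Thm. 4.18 (2) ("Statement (2) follows from Lemma D.1").
[cite: Liu2021, App. D Lemma D.1 (3) (arXiv Lemma 10.1 (3), p. 56)] -/
def LemmaD1_3 (D : LocalOscillatorFamily.{u}) : Prop :=
  3 ≤ D.rank → ∀ (μ μ' : D.Mu) (ε ε' : D.Eps) (χ χ' : D.Chi),
    D.omega μ' ε' χ' = D.omega μ ε χ ↔ (μ' = μ ∧ ε' = ε ∧ χ' = χ)

/-- **[Liu2021, App. D Lemma D.1 (4)]** (TeX l. 5235; extraction p0056 L29 with the macros `\tc\check\chi` dropped), AS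
PRINTED: "If `n = 2` and `ω(μ,ε,χ)` is nonzero, then `ω(μ',ε',χ')` is isomorphic to `ω(μ,ε,χ)` if and only if either
`(μ',ε',χ') = (μ,ε,χ)`, or `μ' = μ^c χ̌`, `χ' = χ`, and `ε' = ε` (resp. `ε' ≠ ε`) when `V` is isotropic (resp.
anisotropic)."  TYPING: for `rank = 2` and `omega μ ε χ ≠ zero`, the displayed equivalence, with `μ^c χ̌` the carrier
`conjMulCheck μ χ` and "`ε' = ε` (resp. `ε' ≠ ε`) when `V` is isotropic (resp. anisotropic)" typed as
`(Isotropic → ε' = ε) ∧ (¬ Isotropic → ε' ≠ ε)`.  (ERRATUM: revision p238614 had `μ' = μ^c` here, see the module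
docstring.) [cite: Liu2021, App. D Lemma D.1 (4) (arXiv Lemma 10.1 (4), p. 56)] -/
def LemmaD1_4 (D : LocalOscillatorFamily.{u}) : Prop :=
  D.rank = 2 → ∀ (μ μ' : D.Mu) (ε ε' : D.Eps) (χ χ' : D.Chi), D.omega μ ε χ ≠ D.zero →
    (D.omega μ' ε' χ' = D.omega μ ε χ ↔
      (μ' = μ ∧ ε' = ε ∧ χ' = χ) ∨
        (μ' = D.conjMulCheck μ χ ∧ χ' = χ ∧ (D.Isotropic → ε' = ε) ∧ (¬ D.Isotropic → ε' ≠ ε)))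

variable {D : LocalOscillatorFamily.{u}}

/-- **Injectivity of `(μ, ε, χ) ↦ [ω(μ, ε, χ)]` for `n ≥ 3`** — our kernel reading of Lemma D.1 (3): the map from
triples to isomorphism classes is injective. [cite: Liu2021, App. D Lemma D.1 (3) (arXiv Lemma 10.1 (3), p. 56)] -/
theorem LemmaD1_3.injective (h : D.LemmaD1_3) (hn : 3 ≤ D.rank) :
    Function.Injective (fun t : D.Mu × D.Eps × D.Chi => D.omega t.1 t.2.1 t.2.2) := by
  rintro ⟨μ, ε, χ⟩ ⟨μ', ε', χ'⟩ hω
  obtain ⟨h1, h2, h3⟩ := (h hn μ μ' ε ε' χ χ').1 hω.symm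
  simp [h1, h2, h3]

/-- **Local separation of the first entry** (the local shape of the global hypothesis `hμ` / `MuSeparated`): for
`n ≥ 3`, `[ω(μ,ε,χ)] = [ω(μ',ε',χ')]` forces `μ = μ'`. [cite: Liu2021, App. D Lemma D.1 (3) (arXiv Lemma 10.1 (3), p. 56)] -/
theorem LemmaD1_3.mu_eq (h : D.LemmaD1_3) (hn : 3 ≤ D.rank) {μ μ' : D.Mu} {ε ε' : D.Eps} {χ χ' : D.Chi}
    (hω : D.omega μ ε χ = D.omega μ' ε' χ') : μ = μ' :=
  ((h hn μ' μ ε' ε χ' χ).1 hω).1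

/-- **Local shape of [Liu2021] Thm. 4.18 (2)** ("Statement (2) follows from Lemma D.1"): for `n ≥ 3` and a FIXED `μ`,
`(ε, χ) ↦ [ω(μ,ε,χ)]` is injective. [cite: Liu2021, App. D Lemma D.1 (3) and Thm. 4.18 (2)] -/
theorem LemmaD1_3.eps_chi_eq (h : D.LemmaD1_3) (hn : 3 ≤ D.rank) {μ : D.Mu} {ε ε' : D.Eps} {χ χ' : D.Chi}
    (hω : D.omega μ ε χ = D.omega μ ε' χ') : ε = ε' ∧ χ = χ' :=
  let h' := (h hn μ μ ε' ε χ' χ).1 hω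
  ⟨h'.2.1, h'.2.2⟩

/-- **Self-duality criterion read off (2)+(3)**: for `n ≥ 3`, `ω(μ,ε,χ)` is (isomorphic to its) contragredient iff
`μ^c = μ`, `−ε = ε` and `χ^{−1} = χ` — our kernel consequence of the two printed bullets.
[cite: Liu2021, App. D Lemma D.1 (2)–(3) (arXiv Lemma 10.1, p. 56)] -/
theorem dual_eq_self_iff (h2 : D.LemmaD1_2) (h3 : D.LemmaD1_3) (hn : 3 ≤ D.rank) (μ : D.Mu) (ε : D.Eps)
    (χ : D.Chi) :
    D.dual (D.omega μ ε χ) = D.omega μ ε χ ↔ (D.conj μ = μ ∧ D.neg ε = ε ∧ D.inv χ = χ) := by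
  rw [h2 μ ε χ]
  exact h3 hn μ (D.conj μ) ε (D.neg ε) χ (D.inv χ)

end LocalOscillatorFamily

end Literature.RepresentationTheory.Liu2021
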